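import Literature.Barriers.CriticalPhenomena.SupercriticalSAWSpaceFillingBoxes
import Mathlib.Combinatorics.SimpleGraph.Metric
import Literature.Probability.LatticeModels.DoubleCurrents
import HarnessLib

/-!
# Supercritical self-avoiding walks are space-filling (Duminil-Copin–Kozma–Yadin 2014):
# graph distances in `𝔻_δ` and the boxes of a hole

Second file of the proof of Theorem 6 of H. Duminil-Copin, G. Kozma, A. Yadin, *Supercritical
self-avoiding walks are space-filling*, Ann. IHP Probab. Stat. 50 (2014) 315–326
(arXiv:1110.3074) for `Ω = 𝔻` (`DKY2014_thm6_disk` of `SupercriticalSAWSpaceFillingSteps.lean`;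
objects and named facts in `SupercriticalSAWSpaceFillingBoxes.lean`). The printed proof of
Theorem 6 begins: "consider the event `𝒜(s)` that there exists a connected set `S` of
cardinality `s` at distance larger than `6m` of `γ_δ`. Every box intersecting `S` must be
disjoint from `γ_δ`, so there must exist a connected family of at least `s/(2m+1)²` boxes of
size `2m+1` covering `S` and not intersecting `γ_δ`." Near `∂𝔻` the `m`-boxes of `𝔻_δ` do not
cover `𝔻_δ`, so instead each site `w` of the hole is assigned the grid box `holeBox m w`
containing `w` pushed `3N` lattice steps towards the origin in each coordinate (`pushSite`,
`boxIndex`; `N = 2m+2`). This file proves, over the tree's `discreteDomainGraph unitDisk δ`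
(which is `ℤ²` restricted to `𝔻_δ`, `discreteDomainGraph_unitDisk_adj`):

* graph distances in `𝔻_δ` along coordinate boxes (`reachable_and_dist_le_of_box`: if the
  coordinate box spanned by `p, q` lies in `𝔻_δ` then `dist(p,q) ≤ ‖p - q‖₁`), towards the
  origin (`reachable_and_dist_le_toward_origin`) and inside a box of `𝔻_δ`
  (`reachable_and_dist_le_of_mem_mBox`);
* `holeBox m w` is deep once `δ ≤ 1/(3N)²` (`isDeep_holeBox`), each of its sites is within graph
  distance `6N + 2(2m+1)` of `w` (`dist_holeBox_le`), its fibres have at most `(7N)²` sites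
  (`card_filter_holeBox_le`, so a hole of `s` sites has `≥ s/(7N)²` boxes — the printed
  `s/(2m+1)²`), and `ℤ²`-adjacent sites have equal or adjacent hole boxes (`holeBox_adj_or_eq`,
  so a connected hole gives a connected family).
-/

noncomputable section

open Literature.Probability.LatticeModels Literature.Probability.Percolation
  Literature.Probability.RandomPlanarGeometry.SAW

namespace Literature.Barriers.CriticalPhenomena

namespace SupercriticalSAW

/-! ### The graph `𝔻_δ`: membership, reachability and graph distances -/

/-- Membership in `𝔻_δ` in coordinates: `δ² (v₀² + v₁²) < 1`. [folklore] -/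
theorem mem_meshDomain_unitDisk_iff_sq {δ : ℝ} {v : Site 2} :
    v ∈ meshDomain unitDisk δ ↔ δ ^ 2 * ∑ j, ((v j : ℤ) : ℝ) ^ 2 < 1 := by
  rw [meshDomain_unitDisk, mem_meshVertices_unitDisk_iff_sq]

/-- A site whose coordinates are no larger in absolute value than those of a site of `𝔻_δ` lies
in `𝔻_δ`. [folklore] -/
theorem mem_meshDomain_unitDisk_of_abs_le {δ : ℝ} {u v : Site 2}
    (hu : u ∈ meshDomain unitDisk δ) (h : ∀ i, |v i| ≤ |u i|) : v ∈ meshDomain unitDisk δ := by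
  rw [meshDomain_unitDisk] at hu ⊢
  refine mem_meshVertices_unitDisk_of_sq_le hu (Finset.sum_le_sum fun i _ => ?_)
  have h1 : |((v i : ℤ) : ℝ)| ≤ |((u i : ℤ) : ℝ)| := by exact_mod_cast h i
  exact sq_le_sq.2 (by simpa only [abs_abs] using h1)

/-- **Graph distances in `𝔻_δ` along coordinate boxes.** If every site of the coordinate box
spanned by `p` and `q` lies in `𝔻_δ`, then `p` and `q` are joined in `𝔻_δ` at graph distance at
most their `ℓ¹` distance (monotone lattice paths stay in the box). [folklore] -/
theorem reachable_and_dist_le_of_box {δ : ℝ} (q : Site 2) :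
    ∀ (n : ℕ) (p : Site 2), l1Dist 2 p q = n →
      (∀ c : Site 2, (∀ i, min (p i) (q i) ≤ c i ∧ c i ≤ max (p i) (q i)) →
        c ∈ meshDomain unitDisk δ) →
      (discreteDomainGraph unitDisk δ).Reachable p q ∧
        (discreteDomainGraph unitDisk δ).dist p q ≤ n := by
  intro n
  induction n with
  | zero =>
    intro p hn _
    have : p = q := by
      funext i
      have := Finset.sum_eq_zero_iff.1 hn i (Finset.mem_univ i)
      omega
    subst this
    simp
  | succ n ih =>
    intro p hn hbox
    -- a coordinate in which `p` and `q` differ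
    obtain ⟨i, hi⟩ : ∃ i : Fin 2, p i ≠ q i := by
      by_contra hcon
      push Not at hcon
      have : l1Dist 2 p q = 0 := Finset.sum_eq_zero fun j _ => by simp [hcon j]
      omega
    -- one step from `p` towards `q` in that coordinate
    set e : ℤ := if p i < q i then 1 else -1 with he
    set p' : Site 2 := p + Pi.single i e with hp'
    have hp'i : p' i = p i + e := by simp [hp']
    have hp'j : ∀ j, j ≠ i → p' j = p j := fun j hj => by simp [hp', hj]
    have he' : (p i < q i ∧ e = 1) ∨ (q i < p i ∧ e = -1) := by
      rcases lt_or_gt_of_ne hi with h | h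
      · exact Or.inl ⟨h, by simp [he, h]⟩
      · exact Or.inr ⟨h, by simp [he, not_lt.2 h.le]⟩
    -- the new point is in the box, and its box is contained in the old one
    have hbetween : ∀ j, min (p j) (q j) ≤ p' j ∧ p' j ≤ max (p j) (q j) := by
      intro j
      by_cases hj : j = i
      · subst hj
        rw [hp'i]
        rcases he' with ⟨h, h1⟩ | ⟨h, h1⟩ <;> rw [h1] <;>
          exact ⟨by rw [min_def]; split_ifs <;> omega, by rw [max_def]; split_ifs <;> omega⟩
      · rw [hp'j j hj]
        exact ⟨min_le_left _ _, le_max_left _ _⟩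
    have hbox' : ∀ c : Site 2, (∀ j, min (p' j) (q j) ≤ c j ∧ c j ≤ max (p' j) (q j)) →
        c ∈ meshDomain unitDisk δ := by
      intro c hc
      refine hbox c fun j => ?_
      have h1 := hc j
      have h2 := hbetween j
      constructor
      · rw [min_def] at h1 h2 ⊢; split_ifs at h1 h2 ⊢ <;> omega
      · rw [max_def] at h1 h2 ⊢; split_ifs at h1 h2 ⊢ <;> omega
    have hn' : l1Dist 2 p' q = n := by
      have hsum : l1Dist 2 p' q + 1 = l1Dist 2 p q := by
        unfold l1Dist
        rw [Fin.sum_univ_two, Fin.sum_univ_two]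
        fin_cases i
        · have h0 : p' 0 = p 0 + e := hp'i
          have h1 : p' 1 = p 1 := hp'j 1 (by decide)
          rw [h0, h1]
          rcases he' with ⟨h, h2⟩ | ⟨h, h2⟩ <;> simp only [Fin.zero_eta, Fin.isValue] at h <;>
            rw [h2] <;> omega
        · have h0 : p' 0 = p 0 := hp'j 0 (by decide)
          have h1 : p' 1 = p 1 + e := hp'i
          rw [h0, h1]
          rcases he' with ⟨h, h2⟩ | ⟨h, h2⟩ <;> simp only [Fin.mk_one, Fin.isValue] at h <;>
            rw [h2] <;> omega
      omega
    have hp_mem : p ∈ meshDomain unitDisk δ := hbox p fun j => ⟨min_le_left _ _, le_max_left _ _⟩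
    have hp'_mem : p' ∈ meshDomain unitDisk δ := hbox p' hbetween
    have hadj : (discreteDomainGraph unitDisk δ).Adj p p' := by
      rw [discreteDomainGraph_unitDisk_adj]
      refine ⟨(zdGraph_adj_iff _ _).2 ⟨i, ?_⟩, hp_mem, hp'_mem⟩
      rcases he' with ⟨-, h1⟩ | ⟨-, h1⟩
      · left; rw [hp', h1]
      · right; rw [hp', h1]; ext j; by_cases hj : j = i
        · subst hj; simp
        · simp [hj]
    obtain ⟨hreach, hdist⟩ := ih p' hn' hbox'
    refine ⟨hadj.reachable.trans hreach, ?_⟩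
    calc (discreteDomainGraph unitDisk δ).dist p q
        ≤ (discreteDomainGraph unitDisk δ).dist p p' + (discreteDomainGraph unitDisk δ).dist p' q :=
          hadj.reachable.dist_triangle_left q
      _ ≤ 1 + n := by rw [SimpleGraph.dist_eq_one_iff_adj.2 hadj]; exact Nat.add_le_add_left hdist 1
      _ = n + 1 := by ring


/-- Distances toward the origin: if `w ∈ 𝔻_δ` and each coordinate of `w'` lies between `0` and
the corresponding coordinate of `w`, then `w'` is joined to `w` in `𝔻_δ` at graph distance at
most `ℓ¹(w, w')` (the whole coordinate box lies in the disk). [folklore] -/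
theorem reachable_and_dist_le_toward_origin {δ : ℝ} {w w' : Site 2}
    (hw : w ∈ meshDomain unitDisk δ) (h : ∀ i, min 0 (w i) ≤ w' i ∧ w' i ≤ max 0 (w i)) :
    (discreteDomainGraph unitDisk δ).Reachable w w' ∧
      (discreteDomainGraph unitDisk δ).dist w w' ≤ l1Dist 2 w w' := by
  refine reachable_and_dist_le_of_box w' _ w rfl fun c hc => ?_
  refine mem_meshDomain_unitDisk_of_abs_le hw fun i => ?_
  have h1 := hc i
  have h2 := h i
  rw [abs_le]
  constructor
  · rw [min_def] at h1 h2; rw [max_def] at h2; split_ifs at h1 h2 <;>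
      cases abs_cases (w i) <;> omega
  · rw [max_def] at h1 h2; rw [min_def] at h1 h2; split_ifs at h1 h2 <;>
      cases abs_cases (w i) <;> omega

/-- Distances inside a box of `𝔻_δ`: two sites of a box `B(z) ⊆ 𝔻_δ` are joined in `𝔻_δ` at
graph distance at most `2(2m+1)`. [folklore] -/
theorem reachable_and_dist_le_of_mem_mBox {δ : ℝ} {m : ℕ} {z p q : Site 2}
    (hB : ↑(mBox m z) ⊆ meshDomain unitDisk δ) (hp : p ∈ mBox m z) (hq : q ∈ mBox m z) :
    (discreteDomainGraph unitDisk δ).Reachable p q ∧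
      (discreteDomainGraph unitDisk δ).dist p q ≤ 2 * (2 * m + 1) := by
  rw [mem_mBox_iff] at hp hq
  have key := reachable_and_dist_le_of_box (δ := δ) q _ p rfl fun c hc => hB ?_
  · refine ⟨key.1, key.2.trans ?_⟩
    unfold l1Dist
    rw [Fin.sum_univ_two]
    have h0 := hp 0; have h1 := hp 1; have g0 := hq 0; have g1 := hq 1
    omega
  · rw [Finset.mem_coe, mem_mBox_iff]
    intro i
    have h1 := hc i; have h2 := hp i; have h3 := hq i
    rw [min_def] at h1; rw [max_def] at h1
    split_ifs at h1 <;> constructor <;> omega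

/-! ### Pushing sites inwards and the box of a site -/

/-- Push a site `K` steps towards the origin in each coordinate (stopping at `0`).
[cite: DuminilCopinKozmaYadin2014, §3 (proof of Theorem 6: boxes covering the hole S)] -/
def pushSite (K : ℕ) (w : Site 2) : Site 2 := fun i =>
  if (K : ℤ) ≤ w i then w i - K else if w i ≤ -(K : ℤ) then w i + K else 0

/-- The corner `z = (⌊pᵢ/N⌋)ᵢ` of the grid box `B(z)` containing the site `p` (`N = 2m+2`).
[cite: DuminilCopinKozmaYadin2014, §3 (m-boxes)] -/
def boxIndex (m : ℕ) (p : Site 2) : Site 2 := fun i => p i / (2 * (m : ℤ) + 2)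

/-- The box assigned to a site `w` of a hole: the grid box containing `w` pushed `3N` steps
towards the origin (deep inside `𝔻_δ`, and untouched by the walk if `w` is far from it).
[cite: DuminilCopinKozmaYadin2014, §3 (proof of Theorem 6: boxes covering the hole S)] -/
def holeBox (m : ℕ) (w : Site 2) : Site 2 :=
  boxIndex m (pushSite (3 * (2 * m + 2)) w)

/-- Each coordinate of the pushed site lies between `0` and the original coordinate. [folklore] -/
theorem pushSite_between (K : ℕ) (w : Site 2) (i : Fin 2) :
    min 0 (w i) ≤ pushSite K w i ∧ pushSite K w i ≤ max 0 (w i) := by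
  unfold pushSite
  rw [min_def, max_def]
  split_ifs <;> constructor <;> omega

/-- The push moves each coordinate by at most `K`. [folklore] -/
theorem abs_sub_pushSite_le (K : ℕ) (w : Site 2) (i : Fin 2) : |w i - pushSite K w i| ≤ K := by
  unfold pushSite
  rw [abs_le]
  split_ifs <;> constructor <;> omega

/-- The `ℓ¹` distance between a site and its push is at most `2K`. [folklore] -/
theorem l1Dist_pushSite_le (K : ℕ) (w : Site 2) : l1Dist 2 w (pushSite K w) ≤ 2 * K := by
  unfold l1Dist
  rw [Fin.sum_univ_two]
  have h0 := abs_sub_pushSite_le K w 0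
  have h1 := abs_sub_pushSite_le K w 1
  rw [abs_le] at h0 h1
  omega

/-- A site lies in the grid box of its box index. [cite: DuminilCopinKozmaYadin2014, §3 (m-boxes)] -/
theorem mem_mBox_boxIndex (m : ℕ) (p : Site 2) : p ∈ mBox m (boxIndex m p) := by
  rw [mem_mBox_iff]
  intro i
  simp only [boxIndex]
  have hN : (0 : ℤ) < 2 * (m : ℤ) + 2 := by positivity
  have h1 := Int.emod_add_mul_ediv (p i) (2 * (m : ℤ) + 2)
  have h2 := Int.emod_nonneg (p i) hN.ne'
  have h3 := Int.emod_lt_of_pos (p i) hN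
  constructor <;> nlinarith [h1, h2, h3]

/-- The box index of a site of `B(z)` is `z`. [cite: DuminilCopinKozmaYadin2014, §3 (m-boxes)] -/
theorem boxIndex_eq_of_mem_mBox {m : ℕ} {z p : Site 2} (hp : p ∈ mBox m z) : boxIndex m p = z := by
  rw [mem_mBox_iff] at hp
  funext i
  simp only [boxIndex]
  have hN : (0 : ℤ) < 2 * (m : ℤ) + 2 := by positivity
  obtain ⟨h1, h2⟩ := hp i
  have : p i = (p i - (2 * (m : ℤ) + 2) * z i) + z i * (2 * (m : ℤ) + 2) := by ring
  rw [this, Int.add_mul_ediv_right _ _ hN.ne', Int.ediv_eq_zero_of_lt (by linarith) (by linarith),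
    zero_add]

/-- The box index is monotone-`1`-Lipschitz in each coordinate: increasing a coordinate of the
site by `1` keeps the index or increases that coordinate of the index by `1`. [folklore] -/
theorem boxIndex_add_single (m : ℕ) (p : Site 2) (i : Fin 2) :
    boxIndex m (p + Pi.single i 1) = boxIndex m p ∨
      boxIndex m (p + Pi.single i 1) = boxIndex m p + Pi.single i 1 := by
  have hN : (0 : ℤ) < 2 * (m : ℤ) + 2 := by positivity
  have hle : p i / (2 * (m : ℤ) + 2) ≤ (p i + 1) / (2 * (m : ℤ) + 2) :=
    Int.ediv_le_ediv hN (by linarith)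
  have hle' : (p i + 1) / (2 * (m : ℤ) + 2) ≤ p i / (2 * (m : ℤ) + 2) + 1 := by
    have : (p i + 1) / (2 * (m : ℤ) + 2) ≤ (p i + 1 * (2 * (m : ℤ) + 2)) / (2 * (m : ℤ) + 2) :=
      Int.ediv_le_ediv hN (by nlinarith)
    rwa [Int.add_mul_ediv_right _ _ hN.ne'] at this
  have hj : ∀ j, j ≠ i → boxIndex m (p + Pi.single i 1) j = boxIndex m p j := fun j hj => by
    simp [boxIndex, hj]
  have hi : boxIndex m (p + Pi.single i 1) i = (p i + 1) / (2 * (m : ℤ) + 2) := by simp [boxIndex]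
  rcases (show (p i + 1) / (2 * (m : ℤ) + 2) = p i / (2 * (m : ℤ) + 2) ∨
      (p i + 1) / (2 * (m : ℤ) + 2) = p i / (2 * (m : ℤ) + 2) + 1 by omega) with h | h
  · left; funext j
    by_cases hj' : j = i
    · subst hj'; rw [hi, h]; rfl
    · exact hj j hj'
  · right; funext j
    by_cases hj' : j = i
    · subst hj'; rw [hi, h]; simp [boxIndex]
    · rw [hj j hj']; simp [hj']

/-- The push is monotone-`1`-Lipschitz in each coordinate. [folklore] -/
theorem pushSite_add_single (K : ℕ) (w : Site 2) (i : Fin 2) :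
    pushSite K (w + Pi.single i 1) = pushSite K w ∨
      pushSite K (w + Pi.single i 1) = pushSite K w + Pi.single i 1 := by
  have hj : ∀ j, j ≠ i → pushSite K (w + Pi.single i 1) j = pushSite K w j := fun j hj => by
    simp [pushSite, hj]
  have hi : pushSite K (w + Pi.single i 1) i = pushSite K w i ∨
      pushSite K (w + Pi.single i 1) i = pushSite K w i + 1 := by
    simp only [pushSite, Pi.add_apply, Pi.single_eq_same]
    split_ifs <;> omega
  rcases hi with h | h
  · left; funext j
    by_cases hj' : j = i
    · subst hj'; exact h
    · exact hj j hj'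
  · right; funext j
    by_cases hj' : j = i
    · subst hj'; rw [h]; simp
    · rw [hj j hj']; simp [hj']

/-- **Adjacent sites have equal or adjacent hole boxes** (so a connected hole gives a
connected family of boxes). [cite: DuminilCopinKozmaYadin2014, §3 (proof of Theorem 6: "a connected family of … boxes … covering S")] -/
theorem holeBox_adj_or_eq {m : ℕ} {w w' : Site 2} (h : (zdGraph 2).Adj w w') :
    holeBox m w = holeBox m w' ∨ (zdGraph 2).Adj (holeBox m w) (holeBox m w') := by
  -- reduce to `w' = w + eᵢ`
  suffices key : ∀ (w : Site 2) (i : Fin 2), holeBox m w = holeBox m (w + Pi.single i 1) ∨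
      (zdGraph 2).Adj (holeBox m w) (holeBox m (w + Pi.single i 1)) by
    obtain ⟨i, rfl | rfl⟩ := (zdGraph_adj_iff _ _).1 h
    · exact key w i
    · rcases key w' i with h1 | h1
      · exact Or.inl h1.symm
      · exact Or.inr h1.symm
  intro w i
  unfold holeBox
  rcases pushSite_add_single (3 * (2 * m + 2)) w i with h1 | h1
  · left; rw [h1]
  · rw [h1]
    rcases boxIndex_add_single m (pushSite (3 * (2 * m + 2)) w) i with h2 | h2
    · left; rw [h2]
    · right; rw [h2]
      exact (zdGraph_adj_iff _ _).2 ⟨i, Or.inl rfl⟩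


/-! ### The hole box: inside the disk, near the site, deep -/

/-- The pushed site lies in the hole box. [cite: DuminilCopinKozmaYadin2014, §3 (proof of Theorem 6)] -/
theorem pushSite_mem_mBox_holeBox (m : ℕ) (w : Site 2) :
    pushSite (3 * (2 * m + 2)) w ∈ mBox m (holeBox m w) :=
  mem_mBox_boxIndex m _

/-- Membership in `𝔻_δ` as `w₀² + w₁² < (1/δ)²` (for `δ > 0`). [folklore] -/
theorem mem_meshDomain_unitDisk_iff_lt_sq {δ : ℝ} (hδ : 0 < δ) {v : Site 2} :
    v ∈ meshDomain unitDisk δ ↔ ∑ j, ((v j : ℤ) : ℝ) ^ 2 < (1 / δ) ^ 2 := by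
  rw [mem_meshDomain_unitDisk_iff_sq, one_div, inv_pow, ← one_div, lt_div_iff₀ (by positivity),
    mul_comm]

/-- The real-variable core of `isDeep_holeBox`: if `a₀² + a₁² < ρ²`, `ρ ≥ K²`, `K ≥ 2`, and for
each `i` either `cᵢ + 1 ≤ aᵢ` or (`cᵢ + 1 ≤ K` and `aᵢ < K`), then `c₀² + c₁² < ρ²`. [folklore] -/
theorem sq_add_sq_lt_of_push {ρ K a₀ a₁ c₀ c₁ : ℝ} (hK : 2 ≤ K) (hρ : K ^ 2 ≤ ρ)
    (ha₀ : 0 ≤ a₀) (ha₁ : 0 ≤ a₁) (hc₀ : 0 ≤ c₀) (hc₁ : 0 ≤ c₁) (hS : a₀ ^ 2 + a₁ ^ 2 < ρ ^ 2)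
    (h₀ : c₀ + 1 ≤ a₀ ∨ (c₀ + 1 ≤ K ∧ a₀ < K)) (h₁ : c₁ + 1 ≤ a₁ ∨ (c₁ + 1 ≤ K ∧ a₁ < K)) :
    c₀ ^ 2 + c₁ ^ 2 < ρ ^ 2 := by
  have hρ0 : 0 < ρ := by nlinarith
  have hK4 : (4 : ℝ) ≤ K ^ 2 := by nlinarith
  have ha₀ρ : a₀ < ρ := by
    by_contra hcon; push Not at hcon; nlinarith
  have ha₁ρ : a₁ < ρ := by
    by_contra hcon; push Not at hcon; nlinarith
  rcases h₀ with h₀ | ⟨h₀, h₀'⟩ <;> rcases h₁ with h₁ | ⟨h₁, h₁'⟩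
  · have e₀ : c₀ ^ 2 ≤ a₀ ^ 2 := by nlinarith
    have e₁ : c₁ ^ 2 ≤ a₁ ^ 2 := by nlinarith
    linarith
  · -- `c₀ ≤ a₀ - 1 < ρ - 1`, `c₁ ≤ K - 1`
    have e₀ : c₀ ^ 2 ≤ (ρ - 1) ^ 2 - (ρ - a₀) := by nlinarith
    have e₁ : c₁ ^ 2 ≤ (K - 1) ^ 2 := by nlinarith
    nlinarith
  · have e₁ : c₁ ^ 2 ≤ (ρ - 1) ^ 2 - (ρ - a₁) := by nlinarith
    have e₀ : c₀ ^ 2 ≤ (K - 1) ^ 2 := by nlinarith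
    nlinarith
  · have e₀ : c₀ ^ 2 ≤ (K - 1) ^ 2 := by nlinarith
    have e₁ : c₁ ^ 2 ≤ (K - 1) ^ 2 := by nlinarith
    have : ρ ^ 2 ≥ K ^ 2 * K ^ 2 := by nlinarith
    nlinarith

/-- **The hole box is deep** once `δ ≤ 1/(3N)²`: pushing a site of `𝔻_δ` `3N` steps towards the
origin in each coordinate leaves room for the `2N`-thickening of its grid box inside the disk.
[cite: DuminilCopinKozmaYadin2014, §3 (proof of Theorem 6)] -/
theorem isDeep_holeBox {δ : ℝ} {m : ℕ} (hδ : 0 < δ) (hδ' : δ ≤ 1 / (3 * (2 * (m : ℝ) + 2)) ^ 2)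
    {w : Site 2} (hw : w ∈ meshDomain unitDisk δ) : IsDeep δ m (holeBox m w) := by
  intro c hc
  set K : ℕ := 3 * (2 * m + 2) with hK
  have hp := pushSite_mem_mBox_holeBox m w
  rw [mem_mBox_iff] at hp
  rw [mem_thickBox_iff] at hc
  -- integer bookkeeping, coordinate by coordinate
  have key : ∀ i, (|c i| + 1 ≤ |w i|) ∨ (|c i| + 1 ≤ (K : ℤ) ∧ |w i| < K) := by
    intro i
    have h1 := hp i
    have h2 := hc i
    have h3 : (K : ℤ) = 3 * (2 * (m : ℤ) + 2) := by rw [hK]; push_cast; ring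
    simp only [pushSite] at h1
    push_cast at h1 h2
    rw [abs_eq_max_neg, abs_eq_max_neg, max_def, max_def]
    split_ifs at h1 with ha hb <;> split_ifs <;> omega
  -- pass to real numbers
  rw [mem_meshDomain_unitDisk_iff_lt_sq hδ, Fin.sum_univ_two] at hw ⊢
  have hKR : (2 : ℝ) ≤ (K : ℝ) := by rw [hK]; push_cast; linarith
  have hρ : ((K : ℝ)) ^ 2 ≤ 1 / δ := by
    rw [hK]; push_cast
    rw [le_div_iff₀ hδ]
    calc (3 * (2 * (m : ℝ) + 2)) ^ 2 * δ ≤ (3 * (2 * (m : ℝ) + 2)) ^ 2 * (1 / (3 * (2 * (m : ℝ) + 2)) ^ 2) :=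
          mul_le_mul_of_nonneg_left hδ' (by positivity)
      _ = 1 := by field_simp
  have cast_key : ∀ i, (|((c i : ℤ) : ℝ)| + 1 ≤ |((w i : ℤ) : ℝ)|) ∨
      (|((c i : ℤ) : ℝ)| + 1 ≤ (K : ℝ) ∧ |((w i : ℤ) : ℝ)| < K) := by
    intro i
    rcases key i with h | ⟨h, h'⟩
    · left; exact_mod_cast h
    · right; exact ⟨by exact_mod_cast h, by exact_mod_cast h'⟩
  have hS : |((w 0 : ℤ) : ℝ)| ^ 2 + |((w 1 : ℤ) : ℝ)| ^ 2 < (1 / δ) ^ 2 := by simpa only [sq_abs] using hw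
  have := sq_add_sq_lt_of_push hKR hρ (abs_nonneg _) (abs_nonneg _) (abs_nonneg _) (abs_nonneg _)
    hS (cast_key 0) (cast_key 1)
  simpa only [sq_abs] using this

/-- **A hole box is near its site**: every site of `B(holeBox w)` is joined to `w` in `𝔻_δ` at
graph distance at most `6N + 2(2m+1)` (push `≤ 6N` steps towards the origin, then move inside
the box), provided the box lies in `𝔻_δ`. [cite: DuminilCopinKozmaYadin2014, §3 (proof of Theorem 6)] -/
theorem dist_holeBox_le {δ : ℝ} {m : ℕ} {w p : Site 2} (hw : w ∈ meshDomain unitDisk δ)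
    (hB : ↑(mBox m (holeBox m w)) ⊆ meshDomain unitDisk δ) (hp : p ∈ mBox m (holeBox m w)) :
    (discreteDomainGraph unitDisk δ).Reachable w p ∧
      (discreteDomainGraph unitDisk δ).dist w p ≤ 2 * (3 * (2 * m + 2)) + 2 * (2 * m + 1) := by
  obtain ⟨h1, h1'⟩ := reachable_and_dist_le_toward_origin hw (pushSite_between (3 * (2 * m + 2)) w)
  obtain ⟨h2, h2'⟩ := reachable_and_dist_le_of_mem_mBox hB (pushSite_mem_mBox_holeBox m w) hp
  refine ⟨h1.trans h2, (h1.dist_triangle_left p).trans ?_⟩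
  exact Nat.add_le_add (h1'.trans (l1Dist_pushSite_le _ _)) h2'

/-- **Fibres of the hole box map are small**: the sites with a given hole box `z` lie in the
`3N`-thickening of `B(z)`, a square of `(7N)²` sites. [cite: DuminilCopinKozmaYadin2014, §3 (proof of Theorem 6: "at least s/(2m+1)² boxes")] -/
theorem card_filter_holeBox_le (m : ℕ) (S : Finset (Site 2)) (z : Site 2) :
    (S.filter fun w => holeBox m w = z).card ≤ (7 * (2 * m + 2)) ^ 2 := by
  classical
  set K : ℕ := 3 * (2 * m + 2) with hK
  set T : Finset (Site 2) := Fintype.piFinset fun i =>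
    Finset.Icc ((2 * (m : ℤ) + 2) * z i - K) ((2 * (m : ℤ) + 2) * z i + (2 * m + 1) + K) with hT
  have hsub : (S.filter fun w => holeBox m w = z) ⊆ T := by
    intro w hw
    rw [Finset.mem_filter] at hw
    have hp := pushSite_mem_mBox_holeBox m w
    rw [hw.2, mem_mBox_iff] at hp
    rw [hT, Fintype.mem_piFinset]
    intro i
    rw [Finset.mem_Icc]
    have h1 := hp i
    have h2 := abs_sub_pushSite_le (3 * (2 * m + 2)) w i
    rw [abs_le] at h2
    rw [hK]; push_cast
    constructor <;> omega
  refine (Finset.card_le_card hsub).trans ?_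
  rw [hT, Fintype.card_piFinset, Fin.prod_univ_two, Int.card_Icc, Int.card_Icc, hK]
  have : ((2 * (m : ℤ) + 2) * z 0 + (2 * m + 1) + ((3 * (2 * m + 2) : ℕ) : ℤ) + 1 -
      ((2 * (m : ℤ) + 2) * z 0 - ((3 * (2 * m + 2) : ℕ) : ℤ))).toNat = 7 * (2 * m + 2) := by
    push_cast; omega
  rw [this]
  have : ((2 * (m : ℤ) + 2) * z 1 + (2 * m + 1) + ((3 * (2 * m + 2) : ℕ) : ℤ) + 1 -
      ((2 * (m : ℤ) + 2) * z 1 - ((3 * (2 * m + 2) : ℕ) : ℤ))).toNat = 7 * (2 * m + 2) := by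
    push_cast; omega
  rw [this, sq]

/-- Hence a finite set of sites has at least `#S / (7N)²` distinct hole boxes.
[cite: DuminilCopinKozmaYadin2014, §3 (proof of Theorem 6: "at least s/(2m+1)² boxes")] -/
theorem card_le_mul_card_image_holeBox (m : ℕ) (S : Finset (Site 2)) :
    S.card ≤ (7 * (2 * m + 2)) ^ 2 * (S.image (holeBox m)).card := by
  classical
  exact Finset.card_le_mul_card_image _ _ fun z _ => card_filter_holeBox_le m S z

end SupercriticalSAW

end Literature.Barriers.CriticalPhenomena
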